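import Summits.BirchSwinnertonDyer.BirchSwinnertonDyer.Theorems.BiquadraticEisensteinDescentHeegnerTwistCouplingInSupplyQuarticPlusDualKills
import Summits.BirchSwinnertonDyer.BirchSwinnertonDyer.Theorems.BiquadraticEisensteinDescentHeegnerTwistCouplingInSupplyQuarticPartnerDescentDual
import HarnessLib

set_option linter.dupNamespace false -- `Summit.BirchSwinnertonDyer.BirchSwinnertonDyer.Theorems.…` (summit = sub)
set_option autoImplicit false

/-!
# Crux `HeegnerTwistCouplingInSupply` (stmt-BirchSwinnertonDyer-21381) — the quartic `j = 1728` corner, habitat H⁺, IIb: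
# the dual side `S(0, −4r²pq²) = {1, −p}` (`p ≡ 15 (mod 16)`, `(q/p) = +1`, partner `(r/p) = −1`)

Route `BiquadraticEisensteinDescent` (cell `pub/bsd-wall`, width seat `bsd-wall-cm-bed-w4` g13; `--supports` 21381, helper). Descent on
the divisors of `b′ = −4r²pq²` for `E = W_p⁺^{(−rq)} : y² = x³ + r²pq²·x` (Silverman's `S^{(φ)}(E/ℚ)`): ★ `mem_selmer_neg_iff_plus`,
`S(0, −4r²pq²) = {1, −p}`. Of the thirty-two squarefree divisors (no real kills: `cc′ < 0`), `1` and `−p` are the images of `O` and `T`;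
`p, pq, r, rq, 2p, 2pq, 2r, 2rq, −1, −q, −rp, −rpq, −2, −2q, −2rp, −2rpq` die at `p` (`(2/p) = (q/p) = +1`, `(−1/p) = (r/p) = −1`);
`q, 2q, −pq, −2pq` die at `2` (modulo `16`); `rp, rpq, 2rp, 2rpq, −r, −rq, −2r, −2rq` die at `r` (`(p/r) = −1`); `2, −2p` die at `q`
(`(p/q) = −1`) — kills from `…QuarticPlusDualKills`. Numerics (crux memo v2): sharp iff `(r/p) = −1`, partners `5, 13, 29, 37`, no exception.

HONEST FRAMING: a typed sub-corner on one CM family; the crux (residual C⁺) is untouched; BSD is not proved by any of this. THEOREMS ONLY.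
Supports stmt-BirchSwinnertonDyer-21381.
-/

noncomputable section

open scoped Classical

namespace Summit.BirchSwinnertonDyer.BirchSwinnertonDyer.Theorems.BiquadraticEisensteinDescentHeegnerTwistCouplingInSupplyQuarticPlusDescentDual

open Literature.NumberTheory.EllipticCurves Literature.NumberTheory.EllipticCurves.XCubeAddPX
  Summit.BirchSwinnertonDyer.BirchSwinnertonDyer.Theorems.BiquadraticEisensteinDescentHeegnerTwistCouplingInSupplyQuarticTwistLocal
  Summit.BirchSwinnertonDyer.BirchSwinnertonDyer.Theorems.BiquadraticEisensteinDescentHeegnerTwistCouplingInSupplyQuarticTwistDescent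
  Summit.BirchSwinnertonDyer.BirchSwinnertonDyer.Theorems.BiquadraticEisensteinDescentHeegnerTwistCouplingInSupplyQuarticPlusDescent
  Summit.BirchSwinnertonDyer.BirchSwinnertonDyer.Theorems.BiquadraticEisensteinDescentHeegnerTwistCouplingInSupplyQuarticPlusDualKills

variable {p q r : ℕ} [hp : Fact p.Prime] [hq : Fact q.Prime] [hr : Fact r.Prime]

/-- ★ **`S(0, −4r²pq²) = {1, −p}`** (H⁺): primes `p ≡ 15 (mod 16)`, `q ≡ 3 (mod 8)`, `r ≡ 5 (mod 8)` with `(q/p) = +1` and `(r/p) = −1`.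
[cite: SilvermanAEC2009, Prop. X.4.9 and Prop. X.6.1] -/
theorem mem_selmer_neg_iff_plus (hp16 : p % 16 = 15) (hq8 : q % 8 = 3) (hr8 : r % 8 = 5)
    (hsq : IsSquare ((q : ℤ) : ZMod p)) (hnr : ¬ IsSquare ((r : ℤ) : ZMod p)) (d : ℤ) :
    d ∈ twoIsogenySelmerGroup 0 (-(4 * r ^ 2 * p * q ^ 2) : ℤ) ↔ d = 1 ∨ d = -(p : ℤ) := by
  have hP := hp.out
  have hQ := hq.out
  have hR := hr.out
  have hqp : q ≠ p := by rintro rfl; omega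
  have hrp : r ≠ p := by rintro rfl; omega
  have hrq : r ≠ q := by rintro rfl; omega
  have hp0 : (p : ℤ) ≠ 0 := by exact_mod_cast hP.ne_zero
  have hq0 : (q : ℤ) ≠ 0 := by exact_mod_cast hQ.ne_zero
  have hr0 : (r : ℤ) ≠ 0 := by exact_mod_cast hR.ne_zero
  have hb : (-(4 * r ^ 2 * p * q ^ 2) : ℤ) ≠ 0 :=
    neg_ne_zero.mpr (mul_ne_zero (mul_ne_zero (mul_ne_zero (by norm_num) (pow_ne_zero 2 hr0)) hp0) (pow_ne_zero 2 hq0))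
  have hpq : ¬ (p : ℤ) ∣ q := fun h => hqp (((Nat.prime_dvd_prime_iff_eq hP hQ).mp (by exact_mod_cast h))).symm
  have hpr : ¬ (p : ℤ) ∣ r := fun h => hrp (((Nat.prime_dvd_prime_iff_eq hP hR).mp (by exact_mod_cast h))).symm
  have hp2' : ¬ (p : ℤ) ∣ 2 := fun h => by
    have h' : p ∣ 2 := by exact_mod_cast h
    rcases (Nat.dvd_prime Nat.prime_two).mp h' with h'' | h'' <;> omega
  have hpI : Prime (p : ℤ) := Nat.prime_iff_prime_int.mp hP
  have hnd : ∀ m : ℤ, ¬ (p : ℤ) ∣ m → ¬ (p : ℤ) ^ 2 ∣ (p : ℤ) * m := fun m hm => not_sq_dvd_mul_of_not_dvd hm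
  have hp1 : ¬ (p : ℤ) ∣ 1 := fun h => hP.one_lt.ne' (by exact_mod_cast Int.eq_one_of_dvd_one (by positivity) h)
  have hp4' : ¬ (p : ℤ) ∣ 4 := fun h => hp2' (hpI.dvd_of_dvd_pow (show (p : ℤ) ∣ 2 ^ 2 by norm_num; exact h))
  -- divisibility bookkeeping: `p ∤ a·m` for `a ∈ {4, 2, 1}` and `m` a product of `r`'s and `q`'s
  have hrq2 : ¬ (p : ℤ) ∣ r * q ^ 2 := fun h => (hpI.dvd_or_dvd h).elim hpr (fun h' => hpq (hpI.dvd_of_dvd_pow h'))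
  have hrq1 : ¬ (p : ℤ) ∣ r * q := fun h => (hpI.dvd_or_dvd h).elim hpr hpq
  have hr2q2 : ¬ (p : ℤ) ∣ r ^ 2 * q ^ 2 := fun h =>
    (hpI.dvd_or_dvd h).elim (fun h' => hpr (hpI.dvd_of_dvd_pow h')) (fun h' => hpq (hpI.dvd_of_dvd_pow h'))
  have hr2q : ¬ (p : ℤ) ∣ r ^ 2 * q := fun h => (hpI.dvd_or_dvd h).elim (fun h' => hpr (hpI.dvd_of_dvd_pow h')) hpq
  have hY : ∀ a : ℤ, (a = 4 ∨ a = 2) → ∀ m : ℤ, ¬ (p : ℤ) ∣ m → ¬ (p : ℤ) ∣ a * m := by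
    rintro a ha m hm h
    rcases hpI.dvd_or_dvd h with h | h
    · rcases ha with rfl | rfl
      · exact hp4' h
      · exact hp2' h
    · exact hm h
  have hn2q : ¬ (p : ℤ) ∣ 2 * q := hY 2 (Or.inr rfl) _ hpq
  have hn2r : ¬ (p : ℤ) ∣ 2 * r := hY 2 (Or.inr rfl) _ hpr
  have hn2rq : ¬ (p : ℤ) ∣ 2 * (r * q) := hY 2 (Or.inr rfl) _ hrq1
  obtain ⟨-, hrqn, hm4r2q2, hm4r2q, h2r, h2rq, hm2r2q2, hm2r2q, hm1, hmq, h4rq2, h4rq, hm2, hm2q, h2rq2, -, hnr'⟩ :=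
    nonresidues_mod_p_plus (hp8 := by omega) hqp hrp hQ hR hsq hnr
  -- residues mod `r`
  have hnpr : ¬ IsSquare ((p : ℤ) : ZMod r) := fun h =>
    hnr ((Summit.BirchSwinnertonDyer.BirchSwinnertonDyer.Theorems.BiquadraticEisensteinDescentHeegnerTwistCouplingInSupplyQuarticPartnerEuler.isSquare_partner_mod_q_iff
      (q := p) (r := r) (by omega) (by rintro rfl; omega) hrp).mpr h)
  have hqr0 : ((q : ℤ) : ZMod r) ≠ 0 := by
    intro h0
    have : (r : ℤ) ∣ q := (ZMod.intCast_zmod_eq_zero_iff_dvd q r).mp h0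
    have : r ∣ q := by exact_mod_cast this
    exact hrq ((Nat.prime_dvd_prime_iff_eq hR hQ).mp this)
  have h2r0 : ((2 : ℤ) : ZMod r) ≠ 0 := by
    intro h0
    have : (r : ℤ) ∣ 2 := (ZMod.intCast_zmod_eq_zero_iff_dvd 2 r).mp h0
    have h' : r ∣ 2 := by exact_mod_cast this
    rcases (Nat.dvd_prime Nat.prime_two).mp h' with h'' | h'' <;> omega
  haveI : Fact (Nat.Prime 2) := ⟨Nat.prime_two⟩
  obtain ⟨k1, k2, k3, k4⟩ := two_adic_kills_plus_dual (p := p) (q := q) (r := r) hp16 hq8 hr8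
  obtain ⟨b1, b2, b3, b4, b5, b6, b7, b8⟩ := partner_kills_plus (p := p) (q := q) (r := r) hnpr hqr0 h2r0
  obtain ⟨c1, c2⟩ := q_kills_plus (p := p) (q := q) (r := r) hq8 (by omega) hqp hrq hR hsq
  constructor
  · intro hd
    have hsqf := squarefree_of_mem_twoIsogenySelmerGroup hd
    have hd0 : d ≠ 0 := hsqf.ne_zero
    have hdvd : d ∣ (4 * r ^ 2 * p * q ^ 2 : ℤ) := dvd_neg.mp (dvd_of_mem_twoIsogenySelmerGroup hd)
    have key : ∀ d' : ℤ, d * d' = (-(4 * r ^ 2 * p * q ^ 2) : ℤ) → (twoIsogenyQuartic 0 d d').IsLocallySoluble :=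
      fun d' hdd => isLocallySoluble_of_mem hd0 hdd hd
    have hcases :=
      Summit.BirchSwinnertonDyer.BirchSwinnertonDyer.Theorems.BiquadraticEisensteinDescentHeegnerTwistCouplingInSupplyQuarticPartnerDescentDual.natAbs_eq_of_squarefree_dvd_partner'
        (p := p) (q := q) (r := r) hsqf hdvd
    rcases Int.natAbs_eq d with hsgn | hsgn
    · -- `d > 0`
      rcases hcases with (h | h | h | h) | (h | h | h | h) | (h | h | h | h) | (h | h | h | h) <;>
        rw [h] at hsgn <;> push_cast at hsgn <;> subst hsgn
      · exact Or.inl rfl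
      · -- d = 2 : dies at q
        exact absurd ((key (-(2 * r ^ 2 * p * q ^ 2 : ℤ)) (by ring)).2 q) c1
      · -- d = r : dies at p
        refine absurd ((key (-(4 * r * p * q ^ 2 : ℤ)) (by ring)).2 p) ?_
        exact not_isSoluble_padic_of_dvd_right (c := (r : ℤ)) (c' := -(4 * r * p * q ^ 2 : ℤ)) ⟨-(4 * r * q ^ 2), by ring⟩
          (by rw [show (-(4 * r * p * q ^ 2 : ℤ)) = p * (-(4 * (r * q ^ 2))) by ring]
              exact hnd _ (by rw [dvd_neg]; exact hY 4 (Or.inl rfl) _ hrq2)) hnr'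
      · -- d = 2r : dies at p
        refine absurd ((key (-(2 * r * p * q ^ 2 : ℤ)) (by ring)).2 p) ?_
        exact not_isSoluble_padic_of_dvd_right (c := 2 * (r : ℤ)) (c' := -(2 * r * p * q ^ 2 : ℤ)) ⟨-(2 * r * q ^ 2), by ring⟩
          (by rw [show (-(2 * r * p * q ^ 2 : ℤ)) = p * (-(2 * (r * q ^ 2))) by ring]
              exact hnd _ (by rw [dvd_neg]; exact hY 2 (Or.inr rfl) _ hrq2)) h2r
      · -- d = p : dies at p
        refine absurd ((key (-(4 * r ^ 2 * q ^ 2 : ℤ)) (by ring)).2 p) ?_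
        exact not_isSoluble_padic_of_dvd_left (c := (p : ℤ)) (c' := -(4 * r ^ 2 * q ^ 2 : ℤ)) (dvd_refl _)
          (by simpa using hnd 1 hp1) hm4r2q2
      · -- d = 2p : dies at p
        refine absurd ((key (-(2 * r ^ 2 * q ^ 2 : ℤ)) (by ring)).2 p) ?_
        exact not_isSoluble_padic_of_dvd_left (c := 2 * (p : ℤ)) (c' := -(2 * r ^ 2 * q ^ 2 : ℤ)) ⟨2, by ring⟩
          (by rw [show (2 * p : ℤ) = p * 2 by ring]; exact hnd 2 hp2') hm2r2q2
      · -- d = rp : dies at r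
        exact absurd ((key (-(4 * r * q ^ 2 : ℤ)) (by ring)).2 r) b1
      · -- d = 2rp : dies at r
        exact absurd ((key (-(2 * r * q ^ 2 : ℤ)) (by ring)).2 r) b3
      · -- d = q : dies at 2
        exact absurd ((key (-(4 * r ^ 2 * p * q : ℤ)) (by ring)).2 2) k1
      · -- d = 2q : dies at 2
        exact absurd ((key (-(2 * r ^ 2 * p * q : ℤ)) (by ring)).2 2) k2
      · -- d = rq : dies at p
        refine absurd ((key (-(4 * r * p * q : ℤ)) (by ring)).2 p) ?_
        exact not_isSoluble_padic_of_dvd_right (c := (r : ℤ) * q) (c' := -(4 * r * p * q : ℤ)) ⟨-(4 * r * q), by ring⟩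
          (by rw [show (-(4 * r * p * q : ℤ)) = p * (-(4 * (r * q))) by ring]
              exact hnd _ (by rw [dvd_neg]; exact hY 4 (Or.inl rfl) _ hrq1)) hrqn
      · -- d = 2rq : dies at p
        refine absurd ((key (-(2 * r * p * q : ℤ)) (by ring)).2 p) ?_
        exact not_isSoluble_padic_of_dvd_right (c := 2 * (r : ℤ) * q) (c' := -(2 * r * p * q : ℤ)) ⟨-(2 * r * q), by ring⟩
          (by rw [show (-(2 * r * p * q : ℤ)) = p * (-(2 * (r * q))) by ring]
              exact hnd _ (by rw [dvd_neg]; exact hn2rq)) h2rq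
      · -- d = pq : dies at p
        refine absurd ((key (-(4 * r ^ 2 * q : ℤ)) (by ring)).2 p) ?_
        exact not_isSoluble_padic_of_dvd_left (c := (p : ℤ) * q) (c' := -(4 * r ^ 2 * q : ℤ)) ⟨q, by ring⟩ (hnd _ hpq) hm4r2q
      · -- d = 2pq : dies at p
        refine absurd ((key (-(2 * r ^ 2 * q : ℤ)) (by ring)).2 p) ?_
        exact not_isSoluble_padic_of_dvd_left (c := 2 * ((p : ℤ) * q)) (c' := -(2 * r ^ 2 * q : ℤ)) ⟨2 * q, by ring⟩
          (by rw [show (2 * ((p : ℤ) * q)) = p * (2 * q) by ring]; exact hnd _ hn2q) hm2r2q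
      · -- d = rpq : dies at r
        exact absurd ((key (-(4 * r * q : ℤ)) (by ring)).2 r) b2
      · -- d = 2rpq : dies at r
        exact absurd ((key (-(2 * r * q : ℤ)) (by ring)).2 r) b4
    · -- `d < 0`
      rcases hcases with (h | h | h | h) | (h | h | h | h) | (h | h | h | h) | (h | h | h | h) <;>
        rw [h] at hsgn <;> push_cast at hsgn <;> subst hsgn
      · -- d = -1 : dies at p
        refine absurd ((key (4 * r ^ 2 * p * q ^ 2) (by ring)).2 p) ?_
        exact not_isSoluble_padic_of_dvd_right (c := -1) (c' := 4 * r ^ 2 * p * q ^ 2) ⟨4 * r ^ 2 * q ^ 2, by ring⟩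
          (by rw [show (4 * r ^ 2 * p * q ^ 2 : ℤ) = p * (4 * (r ^ 2 * q ^ 2)) by ring]
              exact hnd _ (hY 4 (Or.inl rfl) _ hr2q2)) hm1
      · -- d = -2 : dies at p
        refine absurd ((key (2 * r ^ 2 * p * q ^ 2) (by ring)).2 p) ?_
        exact not_isSoluble_padic_of_dvd_right (c := -2) (c' := 2 * r ^ 2 * p * q ^ 2) ⟨2 * r ^ 2 * q ^ 2, by ring⟩
          (by rw [show (2 * r ^ 2 * p * q ^ 2 : ℤ) = p * (2 * (r ^ 2 * q ^ 2)) by ring]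
              exact hnd _ (hY 2 (Or.inr rfl) _ hr2q2)) hm2
      · -- d = -r : dies at r
        exact absurd ((key (4 * r * p * q ^ 2) (by ring)).2 r) b5
      · -- d = -2r : dies at r
        exact absurd ((key (2 * r * p * q ^ 2) (by ring)).2 r) b7
      · exact Or.inr rfl
      · -- d = -2p : dies at q
        exact absurd ((key (2 * r ^ 2 * q ^ 2) (by ring)).2 q) c2
      · -- d = -rp : dies at p
        refine absurd ((key (4 * r * q ^ 2) (by ring)).2 p) ?_
        exact not_isSoluble_padic_of_dvd_left (c := -((r : ℤ) * p)) (c' := 4 * r * q ^ 2) ⟨-r, by ring⟩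
          (by rw [show (-((r : ℤ) * p)) = p * (-r) by ring]; exact hnd _ (by rwa [dvd_neg])) h4rq2
      · -- d = -2rp : dies at p
        refine absurd ((key (2 * r * q ^ 2) (by ring)).2 p) ?_
        exact not_isSoluble_padic_of_dvd_left (c := -(2 * (r : ℤ) * p)) (c' := 2 * r * q ^ 2) ⟨-(2 * r), by ring⟩
          (by rw [show (-(2 * (r : ℤ) * p)) = p * (-(2 * r)) by ring]; exact hnd _ (by rwa [dvd_neg])) h2rq2
      · -- d = -q : dies at p
        refine absurd ((key (4 * r ^ 2 * p * q) (by ring)).2 p) ?_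
        exact not_isSoluble_padic_of_dvd_right (c := -(q : ℤ)) (c' := 4 * r ^ 2 * p * q) ⟨4 * r ^ 2 * q, by ring⟩
          (by rw [show (4 * r ^ 2 * p * q : ℤ) = p * (4 * (r ^ 2 * q)) by ring]; exact hnd _ (hY 4 (Or.inl rfl) _ hr2q)) hmq
      · -- d = -2q : dies at p
        refine absurd ((key (2 * r ^ 2 * p * q) (by ring)).2 p) ?_
        exact not_isSoluble_padic_of_dvd_right (c := -(2 * (q : ℤ))) (c' := 2 * r ^ 2 * p * q) ⟨2 * r ^ 2 * q, by ring⟩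
          (by rw [show (2 * r ^ 2 * p * q : ℤ) = p * (2 * (r ^ 2 * q)) by ring]; exact hnd _ (hY 2 (Or.inr rfl) _ hr2q)) hm2q
      · -- d = -rq : dies at r
        exact absurd ((key (4 * r * p * q) (by ring)).2 r) b6
      · -- d = -2rq : dies at r
        exact absurd ((key (2 * r * p * q) (by ring)).2 r) b8
      · -- d = -pq : dies at 2
        exact absurd ((key (4 * r ^ 2 * q) (by ring)).2 2) k3
      · -- d = -2pq : dies at 2
        exact absurd ((key (2 * r ^ 2 * q) (by ring)).2 2) k4
      · -- d = -rpq : dies at p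
        refine absurd ((key (4 * r * q) (by ring)).2 p) ?_
        exact not_isSoluble_padic_of_dvd_left (c := -((r : ℤ) * (p * q))) (c' := 4 * r * q) ⟨-(r * q), by ring⟩
          (by rw [show (-((r : ℤ) * (p * q))) = p * (-(r * q)) by ring]; exact hnd _ (by rwa [dvd_neg])) h4rq
      · -- d = -2rpq : dies at p
        refine absurd ((key (2 * r * q) (by ring)).2 p) ?_
        exact not_isSoluble_padic_of_dvd_left (c := -(2 * (r : ℤ) * (p * q))) (c' := 2 * r * q) ⟨-(2 * (r * q)), by ring⟩
          (by rw [show (-(2 * (r : ℤ) * (p * q))) = p * (-(2 * (r * q))) by ring]; exact hnd _ (by rwa [dvd_neg])) h2rq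
  · rintro (rfl | rfl)
    · exact one_mem_twoIsogenySelmerGroup 0 hb
    · refine mem_twoIsogenySelmerGroup_of_isSquare hb ?_ ⟨4 * r ^ 2 * q ^ 2, by ring⟩ ⟨2 * r * q, ?_⟩
      · exact Int.squarefree_natAbs.mp (by rw [Int.natAbs_neg, Int.natAbs_natCast]; exact hP.prime.squarefree)
      · rw [show (-(4 * r ^ 2 * p * q ^ 2) : ℤ) = -(p : ℤ) * (4 * r ^ 2 * q ^ 2) by ring,
          Int.mul_ediv_cancel_left _ (neg_ne_zero.mpr hp0)]
        ring

end Summit.BirchSwinnertonDyer.BirchSwinnertonDyer.Theorems.BiquadraticEisensteinDescentHeegnerTwistCouplingInSupplyQuarticPlusDescentDual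

end
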